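import Summits.QuantumFields.YangMills.Theorems.AlphaInputsT3ACv4SeamWindow
import Summits.QuantumFields.YangMills.Theorems.AlphaInputsT3ACv3InClassSelXsOfNestedRegular
import HarnessLib

/-!
# `AlphaInputsT3ACv4RecordNested` — «B1 BY NAME AFTER v4» AS ONE DISPLAY: 2′χ-v4 from [7] Thm 1 + the record sizes + a NESTED-REGULAR CONSTRAINED SELECTION with its χ-data, the
# (71)_sym seam folded into a NUMERAL-FREE `γ₀`-tolerance row — lane `pub-balaban3d`, width seat alpha-2 (g7; v4 package ∕ display owner, ★★OWNER RULINGS g26-№8 ∕ №14 ∕ №20)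

WHY (cell `ym3-torus`, route `UnitScaleTilt`, crux `HistoryTailL` = stmt-QuantumFields-19936; stub 2′χ-v4 `AlphaInputsT3ACv4RecChi`).  LEAD ★w1-19936 g3's B1 reading (07:57:45Z (3)):
«`HistoryTailL ⇐ ⟨T8⟩ ∧ ⟨∀ odd L: a nested-regular constrained selection (✓ `…InClassSelXsOfNestedRegular`: `NestedRegularSelT3 ⇒ InClassSelT3Xs` given the collar) + its Sect. B–C
χ-data⟩`, NO seam row».  The pieces are in the tree: ✓ `…v4RecordSelXs` (this seat: one-currency display `PinnedPartsT3ACRecSelXsV4Chi` ⇒ `AlphaInputsT3ACv4RecChi`), ✓ `…v4SmallFactor71OfRec`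
(★w2-19936 g4: the seam row from `5 ≤ L` + three window numerals), ✓ `…v4SeamWindow` (this seat: the numerals from ONE `γ₀`-row).  THIS FILE knits them into ONE display:
* §1 (O⁗χ) `AlphaInputsT3AC.DataRowsT3NestedChiSel K Ut` := `∃ UkH hU0, NestedRegularSelT3 K Ut UkH ∧ ∃ 𝔖 𝔄, «the three χ data conjuncts VERBATIM»` and
  `dataRowsT3XsChiSel_of_nested (hM₁ : 7·F.L + 3 ≤ 𝔠.M₁)` ((O⁗χ) ⇒ (O‴χₛ));
* §2 the record display `AlphaInputsT3AC.PinnedPartsT3ACRecNestedV4Chi L`: thresholds `(b₁, p₁)`; per profile AND PER TOLERANCE `φ : ℝ → ℝ` positive on `(0, ∞)` (quantified BEFORE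
  `∃ 𝔠`) the record constants with their sizes, `C68`-rows, the collar `7L + 3 ≤ M₁`, the NUMERAL-FREE row `𝔠.gamma0 ≤ ((φ(𝔠.C68)∕(b₀Q₀(p₀)))²)²` («γ₀ below any prescribed positive
  function of C68» — always satisfiable: choose `γ₀` last), [7] Thm 1, and per family (O⁗χ) for some pinned [7]-family whenever one exists — NO seam conjunct, NO numerals (today's
  closer instantiates `φ C := D(L, C)⁻¹` with ★w2's numerals; LF-2's SEAM-L3 `_allL` numerals will instantiate their own `D′` WITHOUT touching this display);
* §3 ★ `pinnedPartsT3ACRecSelXsV4Chi_of_nested (hL5 : 5 ≤ L)` and ★★★ `alphaInputsT3ACv4RecChi_of_pinnedPartsRecNestedV4Chi (hL5 : 5 ≤ L) : PinnedPartsT3ACRecNestedV4Chi L →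
  AlphaInputsT3ACv4RecChi L`;
* §4 the one-supplier form ★★★ `HistoryTailSelSupplier.laneRecordsV4Chi_of_thm1In8_nestedDataRows : ⟨T8 text⟩ → ⟨∀ odd L > 1: floor∕box rows with `∀ φ` and (O⁗χ)⟩ → ∀ L, Odd L →
  5 ≤ L → AlphaInputsT3ACv4RecChi L` — the LF-2 floor BY NAME (at `L = 3` use ✓ `laneRecordsV4Chi_of_thm1In8_selXsDataRows_allL` with the seam displayed).
HONEST FRAMING.  `def … : Prop` below are HYPOTHESIS SCHEMAS, OPEN, never asserted; the theorems are bookkeeping around DISPLAYED rows.  `NestedRegularSelT3` stands for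
[Balaban1985Variational] Thm 1's output for print's (42)-minimiser map (EDGES-B, NOT proved); (O⁗χ)'s data conjuncts are [Balaban1985UV3] Sect. B–C (NODE O, NOT proved); L-FLOOR
(RULING g26-№20): §3–§4 carry `5 ≤ L` because `smallFactor71OfRecT3_of_windows` does (LF-2, consumed only in `EMLIterUniform.step_dominates`, closing by SEAM-L3).  Count-neutral helper
(`--supports stmt-QuantumFields-19936`); registry untouched.  YM₃ on the three-torus is rung R3 of the programme, NOT the Clay problem: nothing here bears on d = 4, infinite volume, or
a mass gap.

References: T. Bałaban, Commun. Math. Phys. 102 (1985) 255–275 [Balaban1985UV3] (Thm 2 p.272, (7) p.257, (40)–(42) p.266, (47) p.267, (67)–(71) p.273); Commun. Math. Phys. 102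
(1985) 277–309 [Balaban1985Variational] ((2)–(3) p.278, Thm 1 (6)–(8) pp.278–279).
-/

set_option autoImplicit false

noncomputable section

namespace Summit.QuantumFields.YangMills.Theorems

open MeasureTheory Set
open scoped Matrix Matrix.Norms.L2Operator
open Literature.MathematicalPhysics.QuantumFieldTheory.Balaban1983to89
open Literature.MathematicalPhysics.QuantumFieldTheory.Balaban1983to89.T3ContinuumYM3Torus
open Literature.MathematicalPhysics.QuantumFieldTheory.Balaban1983to89.T3UnitScaleTilt (θBal)
open Literature.MathematicalPhysics.QuantumFieldTheory.Balaban1983to89.T3PrintedMinimiserExistence (Thm1GlobalMinAt)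
open Literature.MathematicalPhysics.QuantumFieldTheory.Balaban1983to89.T3LowerAlongMinimisersSplit (MinimisersIn8At)
open Literature.MathematicalPhysics.QuantumFieldTheory.Balaban1983to89.ExpMeanLog (deltaSU)
open Literature.MathematicalPhysics.QuantumFieldTheory.Balaban1985CMP102.Setting
open Summit.QuantumFields.Balaban3D.Carriers
open Summit.QuantumFields.Balaban3D.Proofs.Primitives
open Summit.QuantumFields.Balaban3D.Proofs.GroupModelLieC (lieC)
open Summit.QuantumFields.Balaban3D.Proofs.StandardAC
open Summit.QuantumFields.Balaban3D.Proofs.InputsAC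
open Summit.QuantumFields.Balaban3D.Proofs.AlphaAC (AlphaDataAC)
open Summit.QuantumFields.Balaban3D.Proofs.Thresholds (Q0 Q0_pos)
open Summit.QuantumFields.YangMills.Theorems.AlphaV3AC
open B7Prop2Explicit (C0 C0_pos)

/-! ## §1 (O⁗χ): the χ data rows for a nested-regular constrained selection -/

section Schema

variable (F : T3Family) (𝔠 : AlphaConsts F.L (suGroupModel 2).N) (γ : ℝ) (hγ : 0 < γ) (hγ1 : γ ≤ (min 𝔠.gamma0 1) ^ 2)

/-- **(O⁗χ) THE χ CLUSTER-EXPANSION DATA ROWS FOR A NESTED-REGULAR CONSTRAINED SELECTION** (hypothesis schema, never asserted): `DataRowsT3XsChiSel` with the in-class row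
`InClassSelT3Xs` REPLACED by LEAD's displayed supplier predicate `NestedRegularSelT3` (print's (42)-minimiser map: pinned, measurable, nested-regular on the regions, (3) + recorded
largeness at the recorded plaquettes, the top constraint when charged) — the three data conjuncts VERBATIM.
[cite: Balaban1985Variational, (2)–(3) p.278, Thm 1 (8) p.279; Balaban1985UV3, Thm 2 p.272 + (41)–(42) p.266 + (47) p.267 + (67)–(68) p.273] -/
def AlphaInputsT3AC.DataRowsT3NestedChiSel (K : ℕ)
    (Ut : (k : ℕ) → GaugeField (F.P K) k (Matrix.specialUnitaryGroup (Fin 2) ℂ) → GaugeField (F.P K) 0 (Matrix.specialUnitaryGroup (Fin 2) ℂ)) : Prop :=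
  ∃ (UkH : (k : ℕ) → Hist (F.P K) k → GaugeField (F.P K) k (Matrix.specialUnitaryGroup (Fin 2) ℂ) →
      GaugeField (F.P K) 0 (Matrix.specialUnitaryGroup (Fin 2) ℂ))
    (hU0 : ∀ V : GaugeField (F.P K) 0 (Matrix.specialUnitaryGroup (Fin 2) ℂ), UkH 0 (Hist.triv (F.P K) 0) V = V),
    AlphaInputsT3AC.NestedRegularSelT3 F 𝔠 γ hγ hγ1 K Ut UkH ∧
    ∃ (𝔖 : ∀ k, StepSeries (T3Scales F γ hγ (hγ1.trans (sq_min_one_le _ 𝔠.gamma0_pos)) K)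
        (Matrix.specialUnitaryGroup (Fin 2) ℂ) ↥(lieC (suGroupModel 2))
        (nblkOf (T3Scales F γ hγ (hγ1.trans (sq_min_one_le _ 𝔠.gamma0_pos)) K) 𝔠.lane.carrier k) k)
      (𝔄 : AlphaDataAC (suGroupModel 2) 𝔠
        (XT3 F γ hγ (hγ1.trans (sq_min_one_le _ 𝔠.gamma0_pos)) K (fun _ => Set.univ)
          (fun k => UkH (k + 1) (Hist.triv (F.P K) (k + 1))) UkH hU0 (fun _ _ => rfl)) 𝔖),
      (∀ k, k + 1 ≤ K → StepDataV3ChiAC (suGroupModel 2) 𝔠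
        (XT3 F γ hγ (hγ1.trans (sq_min_one_le _ 𝔠.gamma0_pos)) K (fun _ => Set.univ)
          (fun k => UkH (k + 1) (Hist.triv (F.P K) (k + 1))) UkH hU0 (fun _ _ => rfl)) 𝔖 𝔄
        (AlphaInputsT3AC.admWindowT3 F 𝔠 γ hγ hγ1 K) k) ∧
      (∀ h : Hist (F.P K) K, Measurable ((inputOfAC 𝔠.lane
        (XT3 F γ hγ (hγ1.trans (sq_min_one_le _ 𝔠.gamma0_pos)) K (fun _ => Set.univ)
          (fun k => UkH (k + 1) (Hist.triv (F.P K) (k + 1))) UkH hU0 (fun _ _ => rfl)) 𝔖).Pint K h)) ∧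
      (∀ (h : Hist (F.P K) K) (U : GaugeField (F.P K) K (Matrix.specialUnitaryGroup (Fin 2) ℂ)), (inputOfAC 𝔠.lane
        (XT3 F γ hγ (hγ1.trans (sq_min_one_le _ 𝔠.gamma0_pos)) K (fun _ => Set.univ)
          (fun k => UkH (k + 1) (Hist.triv (F.P K) (k + 1))) UkH hU0 (fun _ _ => rfl)) 𝔖).Pint K h U ≤ 𝔄.cP K)

variable {F 𝔠 γ hγ hγ1}

/-- **(O⁗χ) ⇒ (O‴χₛ) UNDER THE COLLAR** (`inClassSelT3Xs_of_nestedRegularSel`: the nested-regular selection is an in-class selection over `𝒞_Xs`; same map, same data).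
[cite: Balaban1985Variational, Thm 1 (8) p.279; Balaban1985UV3, (42) p.266 + (67)–(68) p.273] -/
theorem AlphaInputsT3AC.dataRowsT3XsChiSel_of_nested {K : ℕ} (hM₁ : 7 * F.L + 3 ≤ 𝔠.M₁)
    {Ut : (k : ℕ) → GaugeField (F.P K) k (Matrix.specialUnitaryGroup (Fin 2) ℂ) → GaugeField (F.P K) 0 (Matrix.specialUnitaryGroup (Fin 2) ℂ)}
    (hD : AlphaInputsT3AC.DataRowsT3NestedChiSel F 𝔠 γ hγ hγ1 K Ut) : AlphaInputsT3AC.DataRowsT3XsChiSel F 𝔠 γ hγ hγ1 K Ut := by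
  obtain ⟨UkH, hU0, hsel, 𝔖, 𝔄, hsteps, hPm, hPb⟩ := hD
  exact ⟨UkH, hU0, AlphaInputsT3AC.inClassSelT3Xs_of_nestedRegularSel hM₁ hsel, 𝔖, 𝔄, hsteps, hPm, hPb⟩

end Schema

/-! ## §2 The record display: nested-regular selection, collar, and a numeral-free `γ₀`-tolerance row -/

/-- **2′χ (VERSION 4) DISPLAYED WITH A NESTED-REGULAR CONSTRAINED SELECTION AND A NUMERAL-FREE `γ₀`-TOLERANCE ROW** (hypothesis schema, OPEN, never asserted): thresholds `(b₁, p₁)`;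
for every profile beyond them AND every tolerance `φ : ℝ → ℝ` positive on `(0, ∞)`, record constants `𝔠` with that profile and `(a₀, a₁)` such that: the sizes, `1 ≤ 2B₃`, the
`C68`-rows, the collar `7L + 3 ≤ M₁`, `γ₀ ≤ ((φ(C68)∕(b₀Q₀(p₀)))²)²`, [7] Thm 1, and per family (O⁗χ) for some pinned [7]-family whenever one exists.  NO seam conjunct, NO numerals.
[cite: Balaban1985UV3, (7) p.257, (40)–(42) p.266, (47) p.267, (67)–(71) p.273 and Thm 2 p.272; Balaban1985Variational, (2)–(3) p.278, Thm 1 (6)–(8) pp.278–279] -/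
def AlphaInputsT3AC.PinnedPartsT3ACRecNestedV4Chi (L : ℕ) : Prop :=
  ∃ (b₁ p₁ : ℝ), ∀ (b₀ p₀ : ℝ), b₁ ≤ b₀ → p₁ ≤ p₀ → ∀ (φ : ℝ → ℝ), (∀ x : ℝ, 0 < x → 0 < φ x) →
    ∃ (𝔠 : AlphaConsts L (suGroupModel 2).N) (a₀ a₁ : ℝ), 𝔠.b₀ = b₀ ∧ 𝔠.p₀ = p₀ ∧ 0 < a₀ ∧ 0 < a₁ ∧ 𝔠.B₃ * a₁ ≤ a₀ ∧
      (143 * ((((3 + 4 : ℕ) : ℝ)) ^ 2 / 4) ^ 2) * (2 * (𝔠.B₃ * a₁)) ≤ 1 / 3 ∧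
      2 * (2 * (𝔠.B₃ * a₁)) ≤ 2 * deltaSU (Fin 2) / (((3 + 4) * L : ℕ) : ℝ) ^ 2 ∧
      1 ≤ 2 * 𝔠.B₃ ∧ 4 * 𝔠.B₃ * (L : ℝ) ^ 2 * avgWindowFactor L ≤ 𝔠.C68 ∧
      Real.exp (𝔠.p₀ - 1) ≤ 3 * C0 3 * 𝔠.C68 * (𝔠.b₀ * Q0 𝔠.p₀) ∧
      (𝔠.b₀ * Q0 𝔠.p₀) * (2 * (L : ℝ) ^ 2 * avgWindowFactor L) ^ 2 ≤ 3 * C0 3 * 𝔠.C68 * a₁ ^ 2 ∧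
      7 * L + 3 ≤ 𝔠.M₁ ∧
      𝔠.gamma0 ≤ ((φ 𝔠.C68 / (𝔠.b₀ * Q0 𝔠.p₀)) ^ 2) ^ 2 ∧
      Thm1GlobalMinAt L a₀ a₁ 𝔠.B₃ ∧
      ∀ (F : T3Family) (hF : F.L = L) (γ : ℝ) (hγ : 0 < γ) (hγ1 : γ ≤ (min (hF ▸ 𝔠).gamma0 1) ^ 2) (K : ℕ),
        (∃ Ut : (k : ℕ) → GaugeField (F.P K) k (Matrix.specialUnitaryGroup (Fin 2) ℂ) → GaugeField (F.P K) 0 (Matrix.specialUnitaryGroup (Fin 2) ℂ),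
          AlphaInputsT3AC.TrivMinimiserRowsT3 F (hF ▸ 𝔠) γ hγ hγ1 a₀ a₁ K Ut) →
        ∃ Ut : (k : ℕ) → GaugeField (F.P K) k (Matrix.specialUnitaryGroup (Fin 2) ℂ) → GaugeField (F.P K) 0 (Matrix.specialUnitaryGroup (Fin 2) ℂ),
          AlphaInputsT3AC.TrivMinimiserRowsT3 F (hF ▸ 𝔠) γ hγ hγ1 a₀ a₁ K Ut ∧ AlphaInputsT3AC.DataRowsT3NestedChiSel F (hF ▸ 𝔠) γ hγ hγ1 K Ut

/-! ## §3 The closers for `L ≥ 5` (today's window numerals instantiate the tolerance) -/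

/-- At a family of block size `L`: the collar (stated with `L`) transports (O⁗χ) to (O‴χₛ) for the constants `hF ▸ 𝔠`. [cite: Balaban1985Variational, Thm 1 (8) p.279; Balaban1985UV3, (42) p.266 + (67)–(68) p.273] -/
theorem AlphaInputsT3AC.selXsRows_of_nestedRows_cast {L : ℕ} {𝔠 : AlphaConsts L (suGroupModel 2).N} {a₀ a₁ : ℝ} (hM₁ : 7 * L + 3 ≤ 𝔠.M₁)
    (F : T3Family) (hF : F.L = L)
    (hN : ∀ (γ : ℝ) (hγ : 0 < γ) (hγ1 : γ ≤ (min (hF ▸ 𝔠).gamma0 1) ^ 2) (K : ℕ),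
      (∃ Ut : (k : ℕ) → GaugeField (F.P K) k (Matrix.specialUnitaryGroup (Fin 2) ℂ) → GaugeField (F.P K) 0 (Matrix.specialUnitaryGroup (Fin 2) ℂ),
        AlphaInputsT3AC.TrivMinimiserRowsT3 F (hF ▸ 𝔠) γ hγ hγ1 a₀ a₁ K Ut) →
      ∃ Ut : (k : ℕ) → GaugeField (F.P K) k (Matrix.specialUnitaryGroup (Fin 2) ℂ) → GaugeField (F.P K) 0 (Matrix.specialUnitaryGroup (Fin 2) ℂ),
        AlphaInputsT3AC.TrivMinimiserRowsT3 F (hF ▸ 𝔠) γ hγ hγ1 a₀ a₁ K Ut ∧ AlphaInputsT3AC.DataRowsT3NestedChiSel F (hF ▸ 𝔠) γ hγ hγ1 K Ut) :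
    ∀ (γ : ℝ) (hγ : 0 < γ) (hγ1 : γ ≤ (min (hF ▸ 𝔠).gamma0 1) ^ 2) (K : ℕ),
      (∃ Ut : (k : ℕ) → GaugeField (F.P K) k (Matrix.specialUnitaryGroup (Fin 2) ℂ) → GaugeField (F.P K) 0 (Matrix.specialUnitaryGroup (Fin 2) ℂ),
        AlphaInputsT3AC.TrivMinimiserRowsT3 F (hF ▸ 𝔠) γ hγ hγ1 a₀ a₁ K Ut) →
      ∃ Ut : (k : ℕ) → GaugeField (F.P K) k (Matrix.specialUnitaryGroup (Fin 2) ℂ) → GaugeField (F.P K) 0 (Matrix.specialUnitaryGroup (Fin 2) ℂ),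
        AlphaInputsT3AC.TrivMinimiserRowsT3 F (hF ▸ 𝔠) γ hγ hγ1 a₀ a₁ K Ut ∧ AlphaInputsT3AC.DataRowsT3XsChiSel F (hF ▸ 𝔠) γ hγ hγ1 K Ut := by
  subst hF
  intro γ hγ hγ1 K hex
  obtain ⟨Ut, hUt, hNe⟩ := hN γ hγ hγ1 K hex
  exact ⟨Ut, hUt, AlphaInputsT3AC.dataRowsT3XsChiSel_of_nested hM₁ hNe⟩

/-- ★ **THE NESTED DISPLAY IMPLIES THE ONE-CURRENCY SEAM DISPLAY for `L ≥ 5`**: `PinnedPartsT3ACRecNestedV4Chi L → PinnedPartsT3ACRecSelXsV4Chi L` — the tolerance instantiated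
with today's numerals `φ C := D(L, C)⁻¹` (`smallFactor71OfRecT3_of_gamma0_cast`), (O⁗χ) ⇒ (O‴χₛ) by the collar.  L-FLOOR: carries `5 ≤ L` (LF-2).
[cite: Balaban1985UV3, (7) p.257 and (67)–(71) p.273; Balaban1985Variational, Thm 1 (8) p.279] -/
theorem AlphaInputsT3AC.pinnedPartsT3ACRecSelXsV4Chi_of_nested {L : ℕ} (hL5 : 5 ≤ L) (h : AlphaInputsT3AC.PinnedPartsT3ACRecNestedV4Chi L) :
    AlphaInputsT3AC.PinnedPartsT3ACRecSelXsV4Chi L := by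
  obtain ⟨b₁, p₁, h⟩ := h
  refine ⟨b₁, p₁, fun b₀ p₀ hb hp => ?_⟩
  obtain ⟨𝔠, a₀, a₁, h1, h2, h3, h4, h5, hA3, hA2, hB₃, hC, hCe, hCa, hM₁, hg, hT, hD⟩ := h b₀ p₀ hb hp
    (fun C => (648000 * (L : ℝ) * C + 2 * (2 * C * ((207360000 * (L : ℝ) + 1331529 / 4) * C ^ 2) + ((207360000 * (L : ℝ) + 1331529 / 4) * C ^ 2) ^ 2) + 1)⁻¹)
    (fun C hC => by positivity)
  exact ⟨𝔠, a₀, a₁, h1, h2, h3, h4, h5, hA3, hA2, hB₃, hC, hCe, hCa, hT, fun F hF =>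
    ⟨AlphaInputsT3AC.smallFactor71OfRecT3_of_gamma0_cast hL5 hg F hF, AlphaInputsT3AC.selXsRows_of_nestedRows_cast hM₁ F hF (hD F hF)⟩⟩

/-- ★★★ **THE VERSION-4 STUB TEXT 2′χ FROM THE NESTED DISPLAY for `L ≥ 5`**: `PinnedPartsT3ACRecNestedV4Chi L → AlphaInputsT3ACv4RecChi L` — 2′χ-v4 re-cut to «(T) [7] Thm 1 + the
record sizes + collar + a `γ₀`-tolerance row + (O⁗χ) ONE nested-regular constrained minimiser selection with its χ data rows»: NO seam, NO comb letter, NO (FL).  L-FLOOR: carries `5 ≤ L`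
(LF-2; at `L = 3` use ✓ `alphaInputsT3ACv4RecChi_of_pinnedPartsRecSelXsV4Chi` with the seam displayed). [cite: Balaban1985UV3, Thm 2 p.272, (47) p.267 and (67)–(71) p.273; Balaban1985Variational, Thm 1 (8) p.279] -/
theorem alphaInputsT3ACv4RecChi_of_pinnedPartsRecNestedV4Chi {L : ℕ} (hL5 : 5 ≤ L) (h : AlphaInputsT3AC.PinnedPartsT3ACRecNestedV4Chi L) :
    AlphaInputsT3ACv4RecChi L :=
  alphaInputsT3ACv4RecChi_of_pinnedPartsRecSelXsV4Chi (AlphaInputsT3AC.pinnedPartsT3ACRecSelXsV4Chi_of_nested hL5 h)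

end Summit.QuantumFields.YangMills.Theorems

/-! ## §4 The one-supplier form with the LF-2 floor by name -/

namespace Summit.QuantumFields.YangMills.Theorems.HistoryTailSelSupplier

open MeasureTheory Set
open scoped Matrix.Norms.L2Operator
open Literature.MathematicalPhysics.QuantumFieldTheory.Balaban1983to89
open Literature.MathematicalPhysics.QuantumFieldTheory.Balaban1983to89.T3ContinuumYM3Torus
open Literature.MathematicalPhysics.QuantumFieldTheory.Balaban1983to89.T3PrintedMinimiserExistence (Thm1GlobalMinAt)
open Literature.MathematicalPhysics.QuantumFieldTheory.Balaban1983to89.T3LowerAlongMinimisersSplit (MinimisersIn8At)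
open Literature.MathematicalPhysics.QuantumFieldTheory.Balaban1983to89.ExpMeanLog (deltaSU)
open Literature.MathematicalPhysics.QuantumFieldTheory.Balaban1985CMP102.Setting
open Summit.QuantumFields.Balaban3D.Carriers
open Summit.QuantumFields.Balaban3D.Proofs.Primitives
open Summit.QuantumFields.Balaban3D.Proofs.Thresholds (Q0 Q0_pos)
open Summit.QuantumFields.YangMills.Theorems.HistoryTailOneSupplier (exists_small_window)
open B7Prop2Explicit (C0 C0_pos)

/-- ★★ **THE NESTED v4 DISPLAY FROM (T) AT ANY CONSTANTS AND THE SUPPLIER ROWS** — `pinnedPartsT3ACRecSelXsV4Chi_of_thm1_rows` with the supplier's record rows := collar + the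
`γ₀`-tolerance row (for every positive tolerance `φ`) and per family∕`(γ, K)` := (O⁗χ) for some pinned [7]-family whenever one exists (`B := max (max B₃ᵀ B₀) ½`; `exists_small_window`).
[cite: Balaban1985Variational, Thm 1 (6)–(8) pp.278–279; Balaban1985UV3, (7) p.257, (40)–(42) p.266, (47) p.267, (67)–(71) p.273 and Thm 2 p.272] -/
theorem pinnedPartsT3ACRecNestedV4Chi_of_thm1_rows {L : ℕ} (hL : 1 < L)
    (hT : ∃ a₀ a₁ B₃ : ℝ, 0 < a₀ ∧ 0 < a₁ ∧ 0 < B₃ ∧ Thm1GlobalMinAt L a₀ a₁ B₃)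
    {B₀ A₀ A₁ : ℝ} (hA₀ : 0 < A₀) (hA₁ : 0 < A₁)
    (hrows : ∀ (B a₀ a₁ : ℝ), B₀ ≤ B → 1 ≤ 2 * B → 0 < a₀ → a₀ ≤ A₀ → 0 < a₁ → a₁ ≤ A₁ → B * a₁ ≤ a₀ →
      (143 * ((((3 + 4 : ℕ) : ℝ)) ^ 2 / 4) ^ 2) * (2 * (B * a₁)) ≤ 1 / 3 →
      2 * (2 * (B * a₁)) ≤ 2 * deltaSU (Fin 2) / (((3 + 4) * L : ℕ) : ℝ) ^ 2 →
      Thm1GlobalMinAt L a₀ a₁ B →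
      ∃ (b₁ p₁ : ℝ), ∀ (b₀ p₀ : ℝ), b₁ ≤ b₀ → p₁ ≤ p₀ → ∀ (φ : ℝ → ℝ), (∀ x : ℝ, 0 < x → 0 < φ x) →
        ∃ 𝔠 : AlphaConsts L (suGroupModel 2).N, 𝔠.b₀ = b₀ ∧ 𝔠.p₀ = p₀ ∧ 𝔠.B₃ = B ∧
          4 * 𝔠.B₃ * (L : ℝ) ^ 2 * avgWindowFactor L ≤ 𝔠.C68 ∧
          Real.exp (𝔠.p₀ - 1) ≤ 3 * C0 3 * 𝔠.C68 * (𝔠.b₀ * Q0 𝔠.p₀) ∧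
          (𝔠.b₀ * Q0 𝔠.p₀) * (2 * (L : ℝ) ^ 2 * avgWindowFactor L) ^ 2 ≤ 3 * C0 3 * 𝔠.C68 * a₁ ^ 2 ∧
          7 * L + 3 ≤ 𝔠.M₁ ∧
          𝔠.gamma0 ≤ ((φ 𝔠.C68 / (𝔠.b₀ * Q0 𝔠.p₀)) ^ 2) ^ 2 ∧
          ∀ (F : T3Family) (hF : F.L = L) (γ : ℝ) (hγ : 0 < γ) (hγ1 : γ ≤ (min (hF ▸ 𝔠).gamma0 1) ^ 2) (K : ℕ),
            (∃ Ut : (k : ℕ) → GaugeField (F.P K) k (Matrix.specialUnitaryGroup (Fin 2) ℂ) →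
                GaugeField (F.P K) 0 (Matrix.specialUnitaryGroup (Fin 2) ℂ),
              AlphaInputsT3AC.TrivMinimiserRowsT3 F (hF ▸ 𝔠) γ hγ hγ1 a₀ a₁ K Ut) →
            ∃ Ut : (k : ℕ) → GaugeField (F.P K) k (Matrix.specialUnitaryGroup (Fin 2) ℂ) →
                GaugeField (F.P K) 0 (Matrix.specialUnitaryGroup (Fin 2) ℂ),
              AlphaInputsT3AC.TrivMinimiserRowsT3 F (hF ▸ 𝔠) γ hγ hγ1 a₀ a₁ K Ut ∧
                AlphaInputsT3AC.DataRowsT3NestedChiSel F (hF ▸ 𝔠) γ hγ hγ1 K Ut) :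
    AlphaInputsT3AC.PinnedPartsT3ACRecNestedV4Chi L := by
  obtain ⟨aT₀, aT₁, BT, haT₀, haT₁, hBT, hT⟩ := hT
  set B : ℝ := max (max BT B₀) (1 / 2) with hB_def
  have hBT_le : BT ≤ B := (le_max_left _ _).trans (le_max_left _ _)
  have hB₀_le : B₀ ≤ B := (le_max_right _ _).trans (le_max_left _ _)
  have hBhalf : 1 / 2 ≤ B := le_max_right _ _
  have hBpos : 0 < B := lt_of_lt_of_le (by norm_num) hBhalf
  have h2B : 1 ≤ 2 * B := by linarith
  obtain ⟨a₀, a₁, ha₀, ha₀A, ha₁, ha₁A, hwin, hA3, hA2⟩ :=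
    exists_small_window hL hBpos (lt_min hA₀ haT₀) (lt_min hA₁ haT₁)
  have hT' : Thm1GlobalMinAt L a₀ a₁ B :=
    MinimiserPin.thm1GlobalMinAt_mono
      (MinimiserPin.thm1GlobalMinAt_anti hT (ha₀A.trans (min_le_right _ _)) (ha₁A.trans (min_le_right _ _))) le_rfl hBT_le
  obtain ⟨b₁, p₁, hrec⟩ := hrows B a₀ a₁ hB₀_le h2B ha₀ (ha₀A.trans (min_le_left _ _)) ha₁ (ha₁A.trans (min_le_left _ _))
    hwin hA3 hA2 hT'
  refine ⟨b₁, p₁, fun b₀ p₀ hb hp φ hφ => ?_⟩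
  obtain ⟨𝔠, h1, h2, hB3, s1, s2, s3, hM₁, hg, hFO⟩ := hrec b₀ p₀ hb hp φ hφ
  refine ⟨𝔠, a₀, a₁, h1, h2, ha₀, ha₁, by rw [hB3]; exact hwin, by rw [hB3]; exact hA3, by rw [hB3]; exact hA2,
    by rw [hB3]; exact h2B, s1, s2, s3, hM₁, hg, by rw [hB3]; exact hT', fun F hF => hFO F hF⟩

/-- ★★★ **THE v5p10 STUB TEXT AT EVERY ODD `L ≥ 5` ⇐ ⟨v5kC∕v5kD's `stub_thm1In8GlobalMin` TEXT⟩ ∧ (∀ odd `L > 1`, THE NESTED v4 SUPPLIER ROWS)** — at every odd block size a floor `B₀`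
and a box `(0, A₀] × (0, A₁]` on which, for every profile and every positive tolerance `φ`, the record rows (collar, `C68`-rows, `γ₀ ≤ ((φ(C68)∕(b₀Q₀))²)²`) and, per family∕`(γ, K)`, ONE
nested-regular constrained minimiser selection with its [Balaban1985UV3] Sect. B–C χ-data (O⁗χ) are served — print's own shape: NO seam, NO numerals, NO (FL).  L-FLOOR: the
conclusion carries `5 ≤ L` (LF-2, ★★OWNER RULING g26-№20; closing by SEAM-L3). [cite: Balaban1985UV3, (5) p.256, (47) p.267, (67)–(71) p.273 and Thm 2 p.272; Balaban1985Variational, Thm 1 (8) p.279 and Prop 8 p.304] -/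
theorem laneRecordsV4Chi_of_thm1In8_nestedDataRows
    (hT8 : ∀ L : ℕ, Odd L → 1 < L → ∃ a₀ a₁ B₃ : ℝ, 0 < a₀ ∧ 0 < a₁ ∧ 0 < B₃ ∧
      Thm1GlobalMinAt L a₀ a₁ B₃ ∧ MinimisersIn8At L a₀ a₁ B₃)
    (hrows : ∀ L : ℕ, Odd L → 1 < L → ∃ (B₀ A₀ A₁ : ℝ), 0 < A₀ ∧ 0 < A₁ ∧
      ∀ (B a₀ a₁ : ℝ), B₀ ≤ B → 1 ≤ 2 * B → 0 < a₀ → a₀ ≤ A₀ → 0 < a₁ → a₁ ≤ A₁ → B * a₁ ≤ a₀ →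
        (143 * ((((3 + 4 : ℕ) : ℝ)) ^ 2 / 4) ^ 2) * (2 * (B * a₁)) ≤ 1 / 3 →
        2 * (2 * (B * a₁)) ≤ 2 * deltaSU (Fin 2) / (((3 + 4) * L : ℕ) : ℝ) ^ 2 →
        Thm1GlobalMinAt L a₀ a₁ B →
        ∃ (b₁ p₁ : ℝ), ∀ (b₀ p₀ : ℝ), b₁ ≤ b₀ → p₁ ≤ p₀ → ∀ (φ : ℝ → ℝ), (∀ x : ℝ, 0 < x → 0 < φ x) →
          ∃ 𝔠 : AlphaConsts L (suGroupModel 2).N, 𝔠.b₀ = b₀ ∧ 𝔠.p₀ = p₀ ∧ 𝔠.B₃ = B ∧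
            4 * 𝔠.B₃ * (L : ℝ) ^ 2 * avgWindowFactor L ≤ 𝔠.C68 ∧
            Real.exp (𝔠.p₀ - 1) ≤ 3 * C0 3 * 𝔠.C68 * (𝔠.b₀ * Q0 𝔠.p₀) ∧
            (𝔠.b₀ * Q0 𝔠.p₀) * (2 * (L : ℝ) ^ 2 * avgWindowFactor L) ^ 2 ≤ 3 * C0 3 * 𝔠.C68 * a₁ ^ 2 ∧
            7 * L + 3 ≤ 𝔠.M₁ ∧
            𝔠.gamma0 ≤ ((φ 𝔠.C68 / (𝔠.b₀ * Q0 𝔠.p₀)) ^ 2) ^ 2 ∧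
            ∀ (F : T3Family) (hF : F.L = L) (γ : ℝ) (hγ : 0 < γ) (hγ1 : γ ≤ (min (hF ▸ 𝔠).gamma0 1) ^ 2) (K : ℕ),
              (∃ Ut : (k : ℕ) → GaugeField (F.P K) k (Matrix.specialUnitaryGroup (Fin 2) ℂ) →
                  GaugeField (F.P K) 0 (Matrix.specialUnitaryGroup (Fin 2) ℂ),
                AlphaInputsT3AC.TrivMinimiserRowsT3 F (hF ▸ 𝔠) γ hγ hγ1 a₀ a₁ K Ut) →
              ∃ Ut : (k : ℕ) → GaugeField (F.P K) k (Matrix.specialUnitaryGroup (Fin 2) ℂ) →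
                  GaugeField (F.P K) 0 (Matrix.specialUnitaryGroup (Fin 2) ℂ),
                AlphaInputsT3AC.TrivMinimiserRowsT3 F (hF ▸ 𝔠) γ hγ hγ1 a₀ a₁ K Ut ∧
                  AlphaInputsT3AC.DataRowsT3NestedChiSel F (hF ▸ 𝔠) γ hγ hγ1 K Ut) :
    ∀ L : ℕ, Odd L → 5 ≤ L → AlphaInputsT3ACv4RecChi L := by
  intro L hLo hL5
  have hL : 1 < L := by omega
  obtain ⟨a₀, a₁, B₃, ha₀, ha₁, hB₃, hT, -⟩ := hT8 L hLo hL
  obtain ⟨B₀, A₀, A₁, hA₀, hA₁, h⟩ := hrows L hLo hL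
  exact alphaInputsT3ACv4RecChi_of_pinnedPartsRecNestedV4Chi hL5
    (pinnedPartsT3ACRecNestedV4Chi_of_thm1_rows hL ⟨a₀, a₁, B₃, ha₀, ha₁, hB₃, hT⟩ hA₀ hA₁ h)

end Summit.QuantumFields.YangMills.Theorems.HistoryTailSelSupplier

end
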